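import Summits.BirchSwinnertonDyer.Rank1Residual.Additive.TameBranchAnalyticShaPotMult
import HarnessLib

/-!
# THE ANALYTIC ORDER OF Ш IS THE CERTIFICATE — the X3 twins (`E[p]` REDUCIBLE), rank 0, EVERY odd `p`:
# Wuthrich 2014 Thm. 16 + a (B)-datum + GZK + modularity + **`p ∤ #Ш_an(E)`** ⟹ `TameBranchRatCharEqAt W p`,
# `Ш(E/ℚ)[p^∞] = 0`, `ℓ = 1`, `BSD(E,p)` and `char_Λ X(E/ℚ_∞) = (Wuthrich element)` on X3♯(G-ord, `e = 2`)
# and on X3♯(M) — NO image hypothesis, NO `p`-adic certificate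
# (cell `b2b-bsdres`, sub-cell additive-p2 = X3♯(G-ord)/X4♯(G-ord), gen 32; part 5)

HONEST FRAMING (cell `b2b-bsdres`, run/shared/lean/b2b/bsd-rank1-residual/, verbatim in every
file): the goal of the cell is to DELETE the COMBINATION-SHAPED residual classes of the
Birch–Swinnerton-Dyer formula for ALL analytic-rank `≤ 1` elliptic curves over `ℚ` — "full BSD
formula for every rank `≤ 1` curve in class `C`" assembled STRICTLY from published theorems — so
that the rank-`≤ 1` remainder becomes exactly the CONSTRUCTION-SHAPED classes, which are TYPED
(missing-input `Prop`s), NOT attempted. This is not "finishing BSD". Sub-cell additive-p2: the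
classes X3♯(G-ord) / X4♯(G-ord) are CONSTRUCTION-SHAPED and stay so; the (M) rows belong to
additive-p1 / n1011 (bricks and class predicates consumed BY NAME); labels / RESIDUAL-MAP marks
UNCHANGED; nothing is booked. Theorems only; published inputs are explicit binders: `hWu` = Wuthrich
2014 Thm. 16 half-eigenspace reading (reducible `E[p]`, NO image hypothesis, every odd `p`), `hmodD` =
BCDT, `hGZK`, `hmod`, and `LeadingTermClauses W p Dh` = Delbourgo 2002 (B) for a height datum (A175 at
`p ≥ 5`; `Delbourgo2002.mainTheorem_three` at `p = 3`; `mainTheorem_potMult` on (M)). No definition, no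
named fact, no `sorry`.

## What and why

Parts 2 and 4 settled the big-image defect-2 rows at rank 0 from `p ∤ #Ш_an(E)`. The REDUCIBLE rows
(X3) have their own integral bricks — gen 19's `isTorsion_and_exists_iota_eq_branch_of_wuthrichComponent`
on X3♯(G-ord, `e = 2`) and n1011-p07's `AdditivePotMult.isTorsion_and_exists_iota_eq_of_wuthrichHalf` on
X3♯(M) — with the SAME shape `ι g = C(u·ϖ)·(branch series)`. §0 isolates the series-agnostic per-datum
step (`charIdeal_eq_span_of_iota_eq_C_mul_of_shaAn_unit_rankZero`: ANY `g ∈ char_Λ X` with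
`ι g = C(u·c)·S`, `(c·S)(0) ≠ 0`, `v_p((c·S)(0)) + 2t = ord_p s + ord_p ∏c` and `ord_p s ≤ 0` ⟹
`char_Λ X = (g)`, `#Ш[p^∞] = 1`, `ord_p s = 0`, `μ/λ` of every generator `= μ(g)/λ(g)`); §1–§2 are the
HEADLINES, every odd `p` (`p = 3` included):

* **`ClassX3Gord.tameBranchRatCharEqAt_and_bsdp_of_wuthrichHalf_of_shaAn_unit_rankZero`** — X3♯(G-ord) ∩
  `I₀*`, `ord_{s=1} L(E,s) = 0`, a (B)-datum, **`ord_p #Ш_an(E) ≤ 0`** ⟹ **`TameBranchRatCharEqAt W p`**,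
  **`#Ш(E/ℚ)[p^∞] = 1`**, **`ord_p #Ш_an = 0`**, **`BSD(E,p)`**;
* **`ClassX3M.tameBranchRatCharEqAt_and_bsdp_of_wuthrichHalf_of_shaAn_unit_rankZero`** — X3♯(M), same.

Census (EVIDENCE; the rank-0 X3 rows are in the X4-1 calibration cell and the X4-3/hyp_bits tables
only partially): every rank-0 X3 defect-2 pair with `p ∤ #Ш_an` is in scope. Nothing booked; labels
UNCHANGED.

References: Wuthrich 2014 Thm. 16 [Wuthrich2014]; Delbourgo 2002 Thm. (A), (B) p. 40, p. 39
[Delbourgo2002]; Mazur–Tate–Teitelbaum 1986 §I.8, §I.10, §I.13 [MazurTateTeitelbaum1986Invent];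
Pal 2012 Thm. 3.2 [Pal2012]; Greenberg LNM 1716 §4 [GreenbergLNM1716]; Miller 2011 Def. 1.1
[Miller2011LMS]; gen 31 parts 5/7c, gen 32 parts 1, 2, 4. -/

set_option autoImplicit false

noncomputable section

open scoped Classical MatrixGroups ModularForm NumberField

open CongruenceSubgroup IsDedekindDomain WeierstrassCurve NumberField
  Literature.NumberTheory.EllipticCurves
  Literature.NumberTheory.EllipticCurves.ModularForms
  Literature.NumberTheory.EllipticCurves.Rank1Residual
  Literature.NumberTheory.EllipticCurves.Rank1Residual.Typed
  Literature.NumberTheory.EllipticCurves.Delbourgo2002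
  Literature.NumberTheory.GaloisRepresentations
  Summit.BirchSwinnertonDyer.Rank1Residual.AdditivePotMult
  Summit.BirchSwinnertonDyer.Rank1Residual.X1.MuLambda
  Summit.BirchSwinnertonDyer.Rank1Residual.X1.RankOneParitySqueeze
  Summit.BirchSwinnertonDyer.Rank1Residual.X11a.LambdaNorm

namespace Summit.BirchSwinnertonDyer.Rank1Residual.Additive

/-! ### §0 Per datum, series-agnostic: `ι g = C(u·c)·S`, `v_p((c·S)(0)) + 2t = ord_p s + ord_p ∏c`, `ord_p s ≤ 0` -/

namespace TameBranchAnalyticSha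

variable {W : WeierstrassCurve ℚ} [W.IsElliptic] {p : ℕ} [hp : Fact p.Prime]

/-- **Per datum, series-agnostic rank-0 step.** `p ≠ 2`, `rank_ℤ E(ℚ) = 0`, a (B)-datum, a cyclotomic
dual datum with `X` torsion, ANY `g ∈ char_Λ X` with `ι g = C(u·c)·S` (`u ∈ ℤ_p^×`), `(c·S)(0) ≠ 0`,
`v_p((c·S)(0)) + 2·ord_p #tors = ord_p s + ord_p ∏c` and **`ord_p s ≤ 0`**. Then **`char_Λ X = (g)`**,
**`#Ш(E/ℚ)[p^∞] = 1`**, **`ord_p s = 0`**, and every generator has `μ = μ(g)`, `λ = λ(g)` (part 1's full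
squeeze + part 2's upper half at `T = 0`). [cite: GreenbergLNM1716, §4 pp. 102–110] [cite: Delbourgo2002, Theorem (B) (p. 40)] -/
theorem charIdeal_eq_span_of_iota_eq_C_mul_of_shaAn_unit_rankZero (hp2 : p ≠ 2)
    (hr0 : W.mordellWeilRank = 0) {Dh : PAdicHeightData W p} (hBcl : LeadingTermClauses W p Dh)
    {κ : ZpExtension ℚ p} {γ : Field.absoluteGaloisGroup ℚ}
    (hκ : κ.IsCyclotomic) (hγ : κ.IsTopGenerator γ) (hγ' : IsCyclotomicVariable p γ)
    (D : W.SelmerDualData κ γ) [Module.Finite (IwasawaAlgebra p) D.X] (hX : D.IsTorsion)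
    {g : IwasawaAlgebra p} (hg : g ∈ D.charIdeal) {u : ℤ_[p]ˣ} {c : ℚ_[p]} {S : PowerSeries ℚ_[p]}
    (hι : iwasawaToPowerSeries p g = PowerSeries.C (((u : ℤ_[p]) : ℚ_[p]) * c) * S)
    (hS0 : PowerSeries.constantCoeff (PowerSeries.C c * S) ≠ 0) {s : ℚ}
    (hdict : (PowerSeries.constantCoeff (PowerSeries.C c * S)).valuation + 2 * padicValNat p W.torsionOrder =
      padicValRat p s + padicValNat p W.tamagawaProduct)
    (hsv : padicValRat p s ≤ 0) :
    D.charIdeal = Ideal.span {g} ∧ Nat.card (AddCommGroup.primaryComponent W.sha p) = 1 ∧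
      padicValRat p s = 0 ∧
      ∀ fE : IwasawaAlgebra p, D.charIdeal = Ideal.span {fE} → mu fE = mu g ∧ lam fE = lam g := by
  have hX0eq : PowerSeries.constantCoeff (PowerSeries.C (((u : ℤ_[p]) : ℚ_[p]) * c) * S) =
      ((u : ℤ_[p]) : ℚ_[p]) * PowerSeries.constantCoeff (PowerSeries.C c * S) := by
    simp only [map_mul, PowerSeries.constantCoeff_C]
    ring
  have hX0 : PowerSeries.constantCoeff (PowerSeries.C (((u : ℤ_[p]) : ℚ_[p]) * c) * S) ≠ 0 := by
    rw [hX0eq]; exact mul_ne_zero (coe_units_ne_zero p u) hS0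
  have hvX : (PowerSeries.constantCoeff (PowerSeries.C (((u : ℤ_[p]) : ℚ_[p]) * c) * S)).valuation +
      2 * padicValNat p W.torsionOrder = padicValRat p s + padicValNat p W.tamagawaProduct := by
    rw [hX0eq, Padic.valuation_mul (coe_units_ne_zero p u) hS0, valuation_coe_units_eq_zero, zero_add, hdict]
  haveI : (Literature.NumberTheory.EllipticCurves.Module.charIdeal (IwasawaAlgebra p) D.X).IsPrincipal :=
    charIdeal_isPrincipal_holds p D.X
  obtain ⟨fE, hchar⟩ := Submodule.IsPrincipal.principal
    (Literature.NumberTheory.EllipticCurves.Module.charIdeal (IwasawaAlgebra p) D.X)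
  obtain ⟨hspan, -, -, hcard, -, -⟩ := fullSqueeze_rankZero_of_iota_eq hp2 hr0 hBcl hκ hγ hγ' D hX hchar
    hg hι hX0 (by linarith)
  obtain ⟨-, ℓ, -, hle⟩ := padicValNat_tamagawa_le_valuation_rankZero_of_iota_eq hr0 hBcl hκ hγ hγ' D hX
    hchar hg hι hX0
  have hs0 : padicValRat p s = 0 := by
    have h1 : (0 : ℤ) ≤ padicValNat p (Nat.card (AddCommGroup.primaryComponent W.sha p)) := by
      exact_mod_cast Nat.zero_le _
    have h2 : (0 : ℤ) ≤ padicValNat p ℓ := by exact_mod_cast Nat.zero_le _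
    linarith
  refine ⟨hspan, hcard, hs0, fun fE' hchar' ↦ ?_⟩
  obtain ⟨-, hμ, hlam, -⟩ := fullSqueeze_rankZero_of_iota_eq hp2 hr0 hBcl hκ hγ hγ' D hX hchar' hg hι hX0
    (by linarith)
  exact ⟨hμ, hlam⟩

end TameBranchAnalyticSha

/-! ### §1 X3♯(G-ord, `e = 2`) ∩ `I₀*` (`E[p]` reducible), EVERY odd `p` -/

section ClassLevelX3

open TameBranchMuPart TameBranchAnalyticSha

variable {W : WeierstrassCurve ℚ} [W.IsElliptic] [W.IsGloballyMinimal] {p : ℕ} [hp : Fact p.Prime]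

/-- **HEADLINE X3♯(G-ord), RANK ZERO: THE ANALYTIC ORDER OF Ш IS THE CERTIFICATE.** X3♯(G-ord) ∩ `I₀*`
(`E[p]` reducible), `p` odd, `ord_{s=1} L(E,s) = 0`, a (B)-datum `Dh` (immaterial in rank 0), and
**`ord_p #Ш_an(E) ≤ 0`**. Then **`TameBranchRatCharEqAt W p`**, **`#Ш(E/ℚ)[p^∞] = 1`**, **`ord_p #Ш_an(E) = 0`**,
**`BSD(E,p)`**, and for every twist datum and every cyclotomic dual datum the Wuthrich element GENERATES
`char_Λ X(E/ℚ_∞)` (`ι g = u·ϖ·B^±_{(p−1)/2}(f♭, α)`). Inputs: Wuthrich 2014 Thm. 16 (`hWu`, no image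
hypothesis), BCDT, GZK, modularity, the (B)-datum — and ONE INTEGER of Cremona's table.
[cite: Wuthrich2014, Thm. 16 (p. 397)] [cite: Delbourgo2002, Theorem (A), (B) (p. 40)]
[cite: GreenbergLNM1716, §4 pp. 102–110] [cite: MazurTateTeitelbaum1986Invent, §I.8 (8.6), §I.13–I.14]
[cite: Miller2011LMS, Def. 1.1 (arXiv:1010.2431 p. 3)] -/
theorem ClassX3Gord.tameBranchRatCharEqAt_and_bsdp_of_wuthrichHalf_of_shaAn_unit_rankZero
    (hWu : Wuthrich2014.thm16_halfEigenCharIdeal_dvd_cyclotomicPrime)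
    (hmodD : nonempty_modularParametrizationData)
    (hGZK : rank_eq_analyticRank_of_analyticRank_le_one) (hmod : hasEntireLFunction_rat)
    (hX : ClassX3Gord W p) (hp2 : p ≠ 2) (he : semistabilityIndex W p = 2)
    (hr : W.analyticRank = 0) {Dh : PAdicHeightData W p} (hBcl : LeadingTermClauses W p Dh)
    {s : ℚ} (hs : shaAn W = (s : ℂ)) (hsv : padicValRat p s ≤ 0) :
    TameBranchRatCharEqAt W p ∧ Nat.card (AddCommGroup.primaryComponent W.sha p) = 1 ∧
      padicValRat p s = 0 ∧ BSDp W p ∧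
      ∀ (V : WeierstrassCurve ℚ) [V.IsElliptic] [V.IsGloballyMinimal] (C : VariableChange ℚ),
        C • V.quadraticTwist ((-1 : ℚ) ^ (p / 2) * p) = W → GoodOrd V p →
        ∀ {N : ℕ} [NeZero N] (f : CuspForm (Gamma0 N) 2), IsNewformOf V f →
        ∀ ϖ : ℚ, (if Even (p / 2) then (ϖ : ℝ) * V.realPeriodRat = plusPeriod f
            else (ϖ : ℝ) * V.imaginaryPeriodRat = minusPeriod f) →
        ∀ (κ : ZpExtension ℚ p) (γ : Field.absoluteGaloisGroup ℚ),
          κ.IsCyclotomic → κ.IsTopGenerator γ → IsCyclotomicVariable p γ → ∀ D : W.SelmerDualData κ γ,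
          ∃ (g : IwasawaAlgebra p) (u : ℤ_[p]ˣ), D.charIdeal = Ideal.span {g} ∧
            iwasawaToPowerSeries p g = PowerSeries.C (((u : ℤ_[p]) : ℚ_[p]) * (ϖ : ℚ_[p])) *
              (if Even (p / 2) then padicLFunctionBranch f ((unitRoot V p : ℤ_[p]) : ℚ_[p]) (p / 2)
                else padicLFunctionMinusBranch f ((unitRoot V p : ℤ_[p]) : ℚ_[p]) (p / 2)) := by
  have hadd : Addv W p := hX.addv
  obtain ⟨hmw, -⟩ := hGZK W (by rw [hr]; norm_num)
  have hr0 : W.mordellWeilRank = 0 := by rw [hmw, hr]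
  have hL : W.entireLFunction 1 ≠ 0 := (W.analyticRank_eq_zero_iff_holds (hmod W)).mp hr
  have hΩ : (W.realPeriodRat : ℂ) ≠ 0 := by exact_mod_cast W.realPeriodRat_pos_holds.ne'
  have hj := padicValRat_j_nonneg_of_typeGOrd W p hX.typeGOrd
  -- the core for ANY admissible twist datum
  have core : ∀ (V : WeierstrassCurve ℚ) [V.IsElliptic] [V.IsGloballyMinimal] (C : VariableChange ℚ),
      C • V.quadraticTwist ((-1 : ℚ) ^ (p / 2) * p) = W → GoodOrd V p →
      ∀ {N : ℕ} [NeZero N] (f : CuspForm (Gamma0 N) 2), IsNewformOf V f →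
      ∀ ϖ : ℚ, (if Even (p / 2) then (ϖ : ℝ) * V.realPeriodRat = plusPeriod f
          else (ϖ : ℝ) * V.imaginaryPeriodRat = minusPeriod f) →
      ∀ (κ : ZpExtension ℚ p) (γ : Field.absoluteGaloisGroup ℚ),
        κ.IsCyclotomic → κ.IsTopGenerator γ → IsCyclotomicVariable p γ → ∀ D : W.SelmerDualData κ γ,
        D.IsTorsion ∧ Nat.card (AddCommGroup.primaryComponent W.sha p) = 1 ∧ padicValRat p s = 0 ∧
        ∃ (g : IwasawaAlgebra p) (u : ℤ_[p]ˣ), D.charIdeal = Ideal.span {g} ∧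
          iwasawaToPowerSeries p g = PowerSeries.C (((u : ℤ_[p]) : ℚ_[p]) * (ϖ : ℚ_[p])) *
            (if Even (p / 2) then padicLFunctionBranch f ((unitRoot V p : ℤ_[p]) : ℚ_[p]) (p / 2)
              else padicLFunctionMinusBranch f ((unitRoot V p : ℤ_[p]) : ℚ_[p]) (p / 2)) := by
    intro V _ _ C hC hV N _ f hf ϖ hϖ κ γ hκ hγ hγ' D
    have hord : IsOrdinaryAt V p :=
      isOrdinaryAt_of_goodOrd_or_mult_of_model_twist W V (pStar_ne_zero p) ⟨C, hC⟩ hj (Or.inl hV)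
    haveI : Module.Finite (IwasawaAlgebra p) D.X :=
      SelmerDualData.module_finite_of_isCyclotomic (W := W) (κ := κ) hκ D hγ
    obtain ⟨hXt, g, hg, u, hι⟩ := isTorsion_and_exists_iota_eq_branch_of_wuthrichComponent W p
      (Wuthrich2014.charIdeal_dvd_padicLFunctionBranch_component_of_half hWu) hj hp2 V
      ⟨C, hC⟩ (Or.inl hV) hX.classX3.1 hκ hγ hγ' hf D ϖ hϖ
    obtain ⟨q, u', hu'0, -, hLq, hA⟩ :=
      exists_rat_and_unit_constantCoeff_branch_eq hmod hp2 hadd V C hC hord hf ϖ hϖ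
    have hq0 : q ≠ 0 := by
      intro h0
      apply hL
      have e : W.entireLFunction 1 = (q : ℂ) * (W.realPeriodRat : ℂ) := by
        rw [← hLq, div_mul_cancel₀ _ hΩ]
      rw [e, h0, Rat.cast_zero, zero_mul]
    have hS0 : PowerSeries.constantCoeff (PowerSeries.C (ϖ : ℚ_[p]) *
        (if Even (p / 2) then padicLFunctionBranch f ((unitRoot V p : ℤ_[p]) : ℚ_[p]) (p / 2)
          else padicLFunctionMinusBranch f ((unitRoot V p : ℤ_[p]) : ℚ_[p]) (p / 2))) ≠ 0 := by
      rw [hA]; exact mul_ne_zero hu'0 (by exact_mod_cast hq0)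
    have hdict := valuation_constantCoeff_branch_add_eq_padicValRat_shaAn_add hmod hGZK hp2 hadd hL V C
      hC hord hf ϖ hϖ hs
    obtain ⟨hspan, hcard, hs0, -⟩ := charIdeal_eq_span_of_iota_eq_C_mul_of_shaAn_unit_rankZero hp2 hr0
      hBcl hκ hγ hγ' D hXt hg hι hS0 hdict hsv
    exact ⟨hXt, hcard, hs0, g, u, hspan, hι⟩
  -- one twist datum and one cyclotomic datum exist
  obtain ⟨V, iV, iVm, C, hV, hC⟩ := hX.exists_goodOrd_pStar_twist_model W p hp2 he
  haveI : NeZero (V.conductorNorm ℤ) := ⟨(V.conductorNorm_pos_holds).ne'⟩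
  obtain ⟨Dm⟩ := hmodD V
  obtain ⟨ϖ, hϖ⟩ := exists_periodRatio_parity (p := p) V Dm
  obtain ⟨κ₀, γ₀, hκ₀, hγ₀, hγ₀', D₀, -, -⟩ := exists_cyclotomic_dualData_generator W p
  obtain ⟨-, hcard, hs0, -⟩ := core V C hC hV Dm.f Dm.isNewformOf ϖ hϖ κ₀ γ₀ hκ₀ hγ₀ hγ₀' D₀
  -- `ϖ ≠ 0`, `B^± ≠ 0` from `L(E,1) ≠ 0`
  have hord : IsOrdinaryAt V p :=
    isOrdinaryAt_of_goodOrd_or_mult_of_model_twist W V (pStar_ne_zero p) ⟨C, hC⟩ hj (Or.inl hV)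
  obtain ⟨q, u', hu'0, -, hLq, hA⟩ :=
    exists_rat_and_unit_constantCoeff_branch_eq hmod hp2 hadd V C hC hord Dm.isNewformOf ϖ hϖ
  have hq0 : q ≠ 0 := by
    intro h0
    apply hL
    have e : W.entireLFunction 1 = (q : ℂ) * (W.realPeriodRat : ℂ) := by
      rw [← hLq, div_mul_cancel₀ _ hΩ]
    rw [e, h0, Rat.cast_zero, zero_mul]
  have h0 : PowerSeries.constantCoeff (PowerSeries.C (ϖ : ℚ_[p]) *
      (if Even (p / 2) then padicLFunctionBranch Dm.f ((unitRoot V p : ℤ_[p]) : ℚ_[p]) (p / 2)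
        else padicLFunctionMinusBranch Dm.f ((unitRoot V p : ℤ_[p]) : ℚ_[p]) (p / 2))) ≠ 0 := by
    rw [hA]; exact mul_ne_zero hu'0 (by exact_mod_cast hq0)
  have hϖ0 : ϖ ≠ 0 := by
    rintro rfl; apply h0; rw [Rat.cast_zero, map_zero, zero_mul, map_zero]
  have hB0 : (if Even (p / 2) then padicLFunctionBranch Dm.f ((unitRoot V p : ℤ_[p]) : ℚ_[p]) (p / 2)
      else padicLFunctionMinusBranch Dm.f ((unitRoot V p : ℤ_[p]) : ℚ_[p]) (p / 2)) ≠ 0 := by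
    intro e; apply h0; rw [e, mul_zero, map_zero]
  refine ⟨?_, hcard, hs0, ⟨hmw, Nat.finite_of_card_ne_zero (by rw [hcard]; exact one_ne_zero), s, hs,
    by rw [hs0, hcard, padicValNat_one_right, Nat.cast_zero]⟩,
    fun V' _ _ C' hC' hV' N' _ f' hf' ϖ' hϖ' κ γ hκ hγ hγ' D ↦
      (core V' C' hC' hV' f' hf' ϖ' hϖ' κ γ hκ hγ hγ' D).2.2.2⟩
  intro κ γ N _ f ε α B _ haddv _ hκ hγ hcv hf _ hα hB D
  obtain ⟨hXt, -, -, g₁, u, hspan, hι⟩ := core V C hC hV Dm.f Dm.isNewformOf ϖ hϖ κ γ hκ hγ hcv D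
  have hnd : ∃ r : ℚ, ratPlusSymbol f r ≠ 0 := by
    refine ⟨0, fun h00 ↦ hL ?_⟩
    rw [hf.entireLFunction_one_eq, h00]
    simp
  exact ⟨hXt, exists_charIdeal_eq_span_and_iota_eq_of_generator hp2 V C hC haddv hV hf hnd Dm hϖ0
    hspan hι hB0 hα hB⟩

end ClassLevelX3

/-! ### §2 X3♯(M) (`E[p]` reducible, `E♭` multiplicative at `p`), EVERY odd `p` -/

section ClassLevelX3M

open TameBranchMuPart TameBranchAnalyticSha

variable {W : WeierstrassCurve ℚ} [W.IsElliptic] [W.IsGloballyMinimal] {p : ℕ} [hp : Fact p.Prime]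

/-- **HEADLINE X3♯(M), RANK ZERO: THE ANALYTIC ORDER OF Ш IS THE CERTIFICATE.** X3♯(M) (`E[p]` reducible,
`E♭` multiplicative at `p`), `p` odd, `ord_{s=1} L(E,s) = 0`, a (B)-datum `Dh` (immaterial in rank 0;
`mainTheorem_potMult`), and **`ord_p #Ш_an(E) ≤ 0`**. Then **`TameBranchRatCharEqAt W p`**,
**`#Ш(E/ℚ)[p^∞] = 1`**, **`ord_p #Ш_an(E) = 0`**, **`BSD(E,p)`**. Inputs: Wuthrich 2014 Thm. 16 (`hWu`), BCDT,
GZK, modularity, the (B)-datum — and ONE INTEGER of Cremona's table. The per-datum integral statement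
(`char_Λ X = (g)`, `ι g = u·ϖ·L^±_p(f♭, a_p)`) is the `core` of the proof. [cite: Wuthrich2014, Thm. 16 (p. 397)]
[cite: Delbourgo2002, Theorem (A), (B) (p. 40), p. 39] [cite: MazurTateTeitelbaum1986Invent, §I.8, §I.10, §I.13]
[cite: Miller2011LMS, Def. 1.1 (arXiv:1010.2431 p. 3)] -/
theorem ClassX3M.tameBranchRatCharEqAt_and_bsdp_of_wuthrichHalf_of_shaAn_unit_rankZero
    (hWu : Wuthrich2014.thm16_halfEigenCharIdeal_dvd_cyclotomicPrime)
    (hmodD : nonempty_modularParametrizationData)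
    (hGZK : rank_eq_analyticRank_of_analyticRank_le_one) (hmod : hasEntireLFunction_rat)
    (hX : ClassX3M W p) (hr : W.analyticRank = 0)
    {Dh : PAdicHeightData W p} (hBcl : LeadingTermClauses W p Dh)
    {s : ℚ} (hs : shaAn W = (s : ℂ)) (hsv : padicValRat p s ≤ 0) :
    TameBranchRatCharEqAt W p ∧ Nat.card (AddCommGroup.primaryComponent W.sha p) = 1 ∧
      padicValRat p s = 0 ∧ BSDp W p := by
  have hp2 : p ≠ 2 := hX.p_ne_two
  have hadd : Addv W p := hX.classX3.2
  obtain ⟨hmw, -⟩ := hGZK W (by rw [hr]; norm_num)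
  have hr0 : W.mordellWeilRank = 0 := by rw [hmw, hr]
  have hL : W.entireLFunction 1 ≠ 0 := (W.analyticRank_eq_zero_iff_holds (hmod W)).mp hr
  obtain ⟨V, iV, iVm, C, hV, hC⟩ := hX.exists_mult_pStar_twist_model
  haveI : NeZero (V.conductorNorm ℤ) := ⟨(V.conductorNorm_pos_holds).ne'⟩
  obtain ⟨Dm⟩ := hmodD V
  obtain ⟨ϖ, hϖ⟩ := exists_periodRatio_parity (p := p) V Dm
  have hirrV : ¬ V.HasIrreducibleModPGaloisRep p := fun hVirr ↦
    hX.classX3.1 ((irr_iff_of_model_twist (W := V) (p := p) (pStar_ne_zero p) ⟨C, hC⟩).mpr hVirr)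
  obtain ⟨hap, -, -⟩ := cuspCoeff_eq_and_ne_zero_and_dvd_of_mult p Dm.isNewformOf hV
  obtain ⟨h0, hdict⟩ := valuation_constantCoeff_branchMult_add_eq_padicValRat_shaAn_add hmod hGZK hp2
    hadd hL V C hC hV Dm.isNewformOf hap ϖ hϖ hs
  -- Wuthrich's element on the (M) branch, `a_p = ±1` by cases
  have hbrick : ∀ (κ : ZpExtension ℚ p) (γ : Field.absoluteGaloisGroup ℚ), κ.IsCyclotomic →
      κ.IsTopGenerator γ → IsCyclotomicVariable p γ → ∀ D : W.SelmerDualData κ γ,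
      D.IsTorsion ∧ ∃ g ∈ D.charIdeal, ∃ u : ℤ_[p]ˣ,
        iwasawaToPowerSeries p g = PowerSeries.C (((u : ℤ_[p]) : ℚ_[p]) * (ϖ : ℚ_[p])) *
          (if Even (p / 2) then padicLFunctionPlusBranchMult Dm.f ((V.LFunction p : ℤ) : ℚ_[p]) (p / 2)
            else padicLFunctionMinusBranchMult Dm.f ((V.LFunction p : ℤ) : ℚ_[p]) (p / 2)) := by
    intro κ γ hκ hγ hγ' D
    by_cases hsp : V.HasSplitMultiplicativeReductionAtPrime p
    · have hap1 : V.LFunction p = 1 := by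
        have e : ((V.LFunction p : ℤ) : ℂ) = ((1 : ℤ) : ℂ) := by
          rw [← hap, (Dm.isNewformOf.cuspCoeff_eq_one_and_sq_of_split hsp).1, Int.cast_one]
        exact_mod_cast e
      rw [hap1]
      simpa only [Int.cast_one] using isTorsion_and_exists_iota_eq_of_wuthrichHalf hWu hp2 V C hC hirrV hκ
        hγ hγ' Dm.isNewformOf D _ (Or.inr (Or.inl ⟨hsp, rfl⟩)) ϖ hϖ
    · have hap1 : V.LFunction p = -1 := by
        have e : ((V.LFunction p : ℤ) : ℂ) = ((-1 : ℤ) : ℂ) := by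
          rw [← hap, (Dm.isNewformOf.cuspCoeff_eq_neg_one_and_dvd_of_nonsplit hV hsp).1, Int.cast_neg,
            Int.cast_one]
        exact_mod_cast e
      rw [hap1]
      simpa only [Int.cast_neg, Int.cast_one] using isTorsion_and_exists_iota_eq_of_wuthrichHalf hWu hp2 V
        C hC hirrV hκ hγ hγ' Dm.isNewformOf D _ (Or.inr (Or.inr ⟨hV, hsp, rfl⟩)) ϖ hϖ
  have core : ∀ (κ : ZpExtension ℚ p) (γ : Field.absoluteGaloisGroup ℚ), κ.IsCyclotomic →
      κ.IsTopGenerator γ → IsCyclotomicVariable p γ → ∀ D : W.SelmerDualData κ γ,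
      D.IsTorsion ∧ Nat.card (AddCommGroup.primaryComponent W.sha p) = 1 ∧ padicValRat p s = 0 ∧
        ∃ (g : IwasawaAlgebra p) (u : ℤ_[p]ˣ), D.charIdeal = Ideal.span {g} ∧
          iwasawaToPowerSeries p g = PowerSeries.C (((u : ℤ_[p]) : ℚ_[p]) * (ϖ : ℚ_[p])) *
            (if Even (p / 2) then padicLFunctionPlusBranchMult Dm.f ((V.LFunction p : ℤ) : ℚ_[p]) (p / 2)
              else padicLFunctionMinusBranchMult Dm.f ((V.LFunction p : ℤ) : ℚ_[p]) (p / 2)) := by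
    intro κ γ hκ hγ hγ' D
    haveI : Module.Finite (IwasawaAlgebra p) D.X :=
      SelmerDualData.module_finite_of_isCyclotomic (W := W) (κ := κ) hκ D hγ
    obtain ⟨hXt, g, hg, u, hι⟩ := hbrick κ γ hκ hγ hγ' D
    obtain ⟨hspan, hcard, hs0, -⟩ := charIdeal_eq_span_of_iota_eq_C_mul_of_shaAn_unit_rankZero hp2 hr0
      hBcl hκ hγ hγ' D hXt hg hι h0 hdict hsv
    exact ⟨hXt, hcard, hs0, g, u, hspan, hι⟩
  obtain ⟨κ₀, γ₀, hκ₀, hγ₀, hγ₀', D₀, -, -⟩ := exists_cyclotomic_dualData_generator W p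
  obtain ⟨-, hcard, hs0, -⟩ := core κ₀ γ₀ hκ₀ hγ₀ hγ₀' D₀
  have hϖ0 : ϖ ≠ 0 := by
    rintro rfl; apply h0; rw [Rat.cast_zero, map_zero, zero_mul, map_zero]
  have hB0 : (if Even (p / 2) then padicLFunctionPlusBranchMult Dm.f ((V.LFunction p : ℤ) : ℚ_[p]) (p / 2)
      else padicLFunctionMinusBranchMult Dm.f ((V.LFunction p : ℤ) : ℚ_[p]) (p / 2)) ≠ 0 := by
    intro e; apply h0; rw [e, mul_zero, map_zero]
  refine ⟨?_, hcard, hs0, ⟨hmw, Nat.finite_of_card_ne_zero (by rw [hcard]; exact one_ne_zero), s, hs,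
    by rw [hs0, hcard, padicValNat_one_right, Nat.cast_zero]⟩⟩
  intro κ γ N _ f ε α B _ haddv _ hκ hγ hcv hf _ hα hB D
  obtain ⟨hXt, -, -, g₁, u, hspan, hι⟩ := core κ γ hκ hγ hcv D
  have hnd : ∃ r : ℚ, ratPlusSymbol f r ≠ 0 := by
    refine ⟨0, fun h00 ↦ hL ?_⟩
    rw [hf.entireLFunction_one_eq, h00]
    simp
  exact ⟨hXt, exists_charIdeal_eq_span_and_iota_eq_of_generator_mult hp2 V C hC haddv hV hf hnd Dm hap
    hϖ0 hspan hι hB0 hα hB⟩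

end ClassLevelX3M

end Summit.BirchSwinnertonDyer.Rank1Residual.Additive

end
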